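/-
Copyright: the b2b-balaban T⁴-continuum CRUX team, row NE7b leaf lineage `t4-ne7b-formalise-leaf-03` (gen 153). Project licence.
-/
import Summits.QuantumFields.BalabanUV.T4Continuum.Spine.NE7b.OneShotChartBoundedUniqueness
import Summits.QuantumFields.BalabanUV.T4Continuum.Spine.NE7b.OneShotChartTorusRows
import Summits.QuantumFields.BalabanUV.T4Continuum.Spine.NE7b.OneShotChartSupSharp

/-!
# A RATIONAL TORUS CERTIFICATE FOR THE SIDE-2 ONE-SHOT SECTION ON `ℤ⁴`, AND THE KERNEL NEGATIVE SUP LETTER: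
# `Σ′_y |H(0,y)| ≥ 1160634059 ∕ 479324085 = 2.4213… > 2`, hence **¬(‖H_2‖_{∞→∞} ≤ 2)** — the pure-sup one-shot chart letter with
# constant `K = M^{(d−2)∕2} = 2` is FALSE at `(M, d) = (2, 4)`, by exact arithmetic at kernel weight (row NE7b, node U5c; PRICING-NE7b v124
# F744 (c) «NL-NE7b-2°», offered to leaf-03; the desk's instrument-16 rational `C_3` made a theorem; [folklore] + an explicit finite certificate)

Cell `pub-balaban`, sub-cell `t4`, spine estimate NE7b (`T4WeightBudget.RelWeightBound`; the cell's OWN estimate — NOT PRINTED in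
[Bałaban 1983–89], NOT PROVED).  Crux-route work under `Spine/NE7b/` by leaf-03 (CRUX team (2), FREEZE (0) crux-prover clause, gen 153).
NOTHING of Bałaban's is asserted; no `T4Continuum/Support` leaf; no `def` (the certificate tables are `local notation` for closed lambda
terms); zero `sorry`; NO `native_decide` — every finite check is a kernel `decide`, so the axioms are the trio.

THE CERTIFICATE.  On the fine torus `(ℤ∕6)⁴` (block side 2, coarse torus `(ℤ∕3)⁴`) the constrained-minimiser column for the coarse delta at
`0` — «minimise the Dirichlet energy subject to block means `δ_{b,0}`», i.e. the KKT system `Q′φ = 16·δ`, `−Δφ` constant on blocks — is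
invariant under the coordinate reflections `p_μ ↦ 1 − p_μ` and permutations, so it is a function of the per-coordinate residue CLASSES
`A = {0,1} ↦ 0`, `B = {2,5} ↦ 1`, `C = {3,4} ↦ 2` and in fact of the two counts `(#B, #C)`: FIFTEEN rationals with common denominator
`D = 479324085` (the table `TT` below; `φ(0) = 1` exactly; exact Gaussian elimination over `ℚ`, this seat, reproducing the pricing desk's
instrument 16).  Read on `ℤ⁴` through `p ↦ p mod 6` it is a bounded `6`-periodic field `PHI`; §3 checks BY `decide` that its Laplacian is
block-constant (`LAPT_norm`) and its block sums are `16·1_{3ℤ⁴}` (`BSUM_eq`), so `OneShotChartBoundedUniqueness.images_eq_of_blockHarmonic`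
IDENTIFIES it with the periodised kernel `Σ′_m H(·, 3m)` (§4); the OWNER's (54) `sum_abs_tsum_kerH_images_le` bounds the torus row below
by the `ℤ⁴` row, and the torus corner row is `Σ_v |TAB v| ∕ D = 1160634059 ∕ 479324085` (§5); leaf-03's SUPSHARP `not_sup_letter_of_rowSum_gt`
turns the strict excess over `2` into the negative letter (§6).

WHAT IS PROVED (d = 4, side 2 i.e. `n = 1`, every `a > 0`):
* §1–§2 per-coordinate residue calculus (`cls_nbr`, `cls_chart`, `nrm_cls`, all by `omega` + `decide`) and the quadruple reindexing
  `sum_pi_fin_four`.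
* §3 the finite checks `TAB_abs_le`, `LAPT_norm`, `BSUM_eq`, `CSUM_eq` (kernel `decide`).
* §4 `lap_PHI` ∕ `lap_PHI_blockConst` ∕ `blockSum_PHI` ∕ `abs_PHI_le` and **`images_eq_PHI`**: `Σ′_m H(p, 3m) = PHI p` for every `p ∈ ℤ⁴`.
* §5 **`rowSum_zero_ge`**: `1160634059 ∕ 479324085 ≤ Σ′_y |kerH 1 a 0 y|`; `two_lt_rowSum_zero`.
* §6 **`not_sup_letter_side_two`**: `¬ ∀ B R, (|B| ≤ R) → ∀ z, |(H_2 B)(z)| ≤ 2·R`; `not_sup_letter_of_lt` (no constant below `2.4213…`).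

HONEST: [folklore] + a finite rational certificate about the FREE scalar block-mean section at ONE side; torus period `R = 3` (the periodised
row is a LOWER bound for every `R`; larger `R` would approach the truth 2.5463); route weight ZERO (the desk: «moves no verdict» — it turns F721 (ii)
into kernel negative knowledge); nothing of (A3) ∕ NC-NE7b-α; BY-NAME EFFECT ON THE WALL: NONE.  NE7b NOT PRINTED ∕ NOT PROVED; spine PROVED 0∕9;
rung (B)+1 on a FINITE torus — NOT infinite volume, NOT the mass gap, NOT Clay.  HONEST DEPENDENCY: continuum YM on T⁴ ⇐ BetaPertH ∧ nine spine
estimates (0∕9 proved); BetaPertH ⇐ (D1) ∧ (D4) ∧ CAP+tail; G-an2-4 gates asym, D1 and NE2∕3∕4.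
-/

set_option autoImplicit false

namespace Summit.QuantumFields.BalabanUV.T4Continuum.NE7b.OneShotChartTorusCertificateSideTwo

open Finset Real
open Literature.MathematicalPhysics.QuantumFieldTheory.Balaban1983to89
open B6QGQLower276 (X e blk B mem_B sum_B chart blk_chart side e_apply_self e_apply_ne)
open B5Hk103ScalarZd (kerH)
open B5Hk165L2Zd (HBZd)
open OneShotChartBoundedUniqueness (images_eq_of_blockHarmonic mem_range_imageShift_iff)
open OneShotChartTorusRows (kerH_translate sum_abs_tsum_kerH_images_le)
open OneShotChartSupSharp (not_sup_letter_of_rowSum_gt)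

noncomputable section

/-! ## §0. The certificate tables (closed lambda terms behind `local notation`; no `def`) -/

set_option quotPrecheck false

/-- class of a fine residue `r = v mod 6`: `A = {0,1} ↦ 0`, `B = {2,5} ↦ 1`, `C = {3,4} ↦ 2`. -/
local notation "CL6" => (fun r : ℤ => if r = 2 ∨ r = 5 then (1 : Fin 3) else if r = 3 ∨ r = 4 then (2 : Fin 3) else (0 : Fin 3))
/-- class of a fine coordinate. -/
local notation "CLS" => (fun v : ℤ => CL6 (v % 6))
/-- the two neighbour classes of a class: `A → {A, B}`, `B → {A, C}`, `C → {B, C}`. -/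
local notation "NB1" => (![0, 0, 1] : Fin 3 → Fin 3)
local notation "NB2" => (![1, 2, 2] : Fin 3 → Fin 3)
/-- block-mate normalisation: `C ↦ B` (the two fine positions of a non-home block carry classes `B`, `C`). -/
local notation "NRM" => (fun c : Fin 3 => if c = 2 then (1 : Fin 3) else c)
/-- class of the fine coordinate `2y + t` from the coarse residue `y mod 3` and the offset `t`. -/
local notation "GG" => (![![0, 0], ![1, 2], ![2, 1]] : Fin 3 → Fin 2 → Fin 3)
/-- coarse residue `y mod 3` as an element of `Fin 3`. -/
local notation "R3" => (fun v : ℤ => if v % 3 = 1 then (1 : Fin 3) else if v % 3 = 2 then (2 : Fin 3) else (0 : Fin 3))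
/-- THE FIFTEEN NUMERATORS, indexed by `(#B, #C)` (common denominator `479324085`). -/
local notation "TT" => (fun (b c : ℕ) => (
  if b = 0 ∧ c = 0 then 479324085 else if b = 1 ∧ c = 0 then 50277321 else if b = 0 ∧ c = 1 then -50277321 else
  if b = 2 ∧ c = 0 then 17486417 else if b = 1 ∧ c = 1 then -7089065 else if b = 0 ∧ c = 2 then -3308287 else
  if b = 3 ∧ c = 0 then 7687973 else if b = 2 ∧ c = 1 then -1256089 else if b = 1 ∧ c = 2 then -1110531 else
  if b = 0 ∧ c = 3 then -588113 else if b = 4 ∧ c = 0 then 3875309 else if b = 3 ∧ c = 1 then -74833 else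
  if b = 2 ∧ c = 2 then -393595 else if b = 1 ∧ c = 3 then -270377 else if b = 0 ∧ c = 4 then -132899 else 0 : ℤ))
/-- the numerator table on class quadruples. -/
local notation "TAB" => (fun (i j k l : Fin 3) => TT
  ((if i = 1 then 1 else 0) + (if j = 1 then 1 else 0) + (if k = 1 then 1 else 0) + (if l = 1 then 1 else 0))
  ((if i = 2 then 1 else 0) + (if j = 2 then 1 else 0) + (if k = 2 then 1 else 0) + (if l = 2 then 1 else 0)))
/-- the class-level Laplacian numerator `8·T(v) − Σ_μ (T(v[μ ↦ NB1]) + T(v[μ ↦ NB2]))`. -/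
local notation "LAPT" => (fun (i j k l : Fin 3) =>
  (8 * TAB i j k l - (TAB (NB1 i) j k l + TAB (NB2 i) j k l) - (TAB i (NB1 j) k l + TAB i (NB2 j) k l)
    - (TAB i j (NB1 k) l + TAB i j (NB2 k) l) - (TAB i j k (NB1 l) + TAB i j k (NB2 l)) : ℤ))
/-- THE CERTIFICATE FIELD on `ℤ⁴` (6-periodic): `PHI p = TAB(classes of p) ∕ 479324085`. -/
local notation "PHI" => (fun p : X 4 => ((TAB (CLS (p 0)) (CLS (p 1)) (CLS (p 2)) (CLS (p 3)) : ℤ) : ℝ) / 479324085)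

/-! ## §1. Per-coordinate residue calculus (`omega` + `decide`) -/

/-- The classes of the two lattice neighbours of `v` are `{NB1, NB2}` of the class of `v`, in one of the two orders. [certificate] -/
theorem cls_nbr (v : ℤ) :
    (CLS (v + 1) = NB1 (CLS v) ∧ CLS (v - 1) = NB2 (CLS v)) ∨ (CLS (v + 1) = NB2 (CLS v) ∧ CLS (v - 1) = NB1 (CLS v)) := by
  beta_reduce
  have h6 : v % 6 = 0 ∨ v % 6 = 1 ∨ v % 6 = 2 ∨ v % 6 = 3 ∨ v % 6 = 4 ∨ v % 6 = 5 := by omega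
  rcases h6 with h | h | h | h | h | h
  · have h1 : (v + 1) % 6 = 1 := by omega
    have h2 : (v - 1) % 6 = 5 := by omega
    rw [h, h1, h2]; decide
  · have h1 : (v + 1) % 6 = 2 := by omega
    have h2 : (v - 1) % 6 = 0 := by omega
    rw [h, h1, h2]; decide
  · have h1 : (v + 1) % 6 = 3 := by omega
    have h2 : (v - 1) % 6 = 1 := by omega
    rw [h, h1, h2]; decide
  · have h1 : (v + 1) % 6 = 4 := by omega
    have h2 : (v - 1) % 6 = 2 := by omega
    rw [h, h1, h2]; decide
  · have h1 : (v + 1) % 6 = 5 := by omega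
    have h2 : (v - 1) % 6 = 3 := by omega
    rw [h, h1, h2]; decide
  · have h1 : (v + 1) % 6 = 0 := by omega
    have h2 : (v - 1) % 6 = 4 := by omega
    rw [h, h1, h2]; decide

/-- The class of the fine coordinate `2y + t` (`t ∈ {0,1}`) is `GG (y mod 3) t`. [certificate] -/
theorem cls_chart (y : ℤ) (t : Fin 2) : CLS (side 1 * y + ((t : ℕ) : ℤ)) = GG (R3 y) t := by
  beta_reduce
  have hs : side 1 = 2 := by unfold side; norm_num
  rw [hs]
  have ht : t = 0 ∨ t = 1 := by
    rcases Fin.exists_fin_two.mp ⟨t, rfl⟩ with h | h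
    · exact Or.inl h
    · exact Or.inr h
  have h3 : y % 3 = 0 ∨ y % 3 = 1 ∨ y % 3 = 2 := by omega
  rcases ht with rfl | rfl <;> rcases h3 with h | h | h
  · have h1 : (2 * y + (((0 : Fin 2) : ℕ) : ℤ)) % 6 = 0 := by simp only [Fin.val_zero, Nat.cast_zero]; omega
    rw [h, h1]; decide
  · have h1 : (2 * y + (((0 : Fin 2) : ℕ) : ℤ)) % 6 = 2 := by simp only [Fin.val_zero, Nat.cast_zero]; omega
    rw [h, h1]; decide
  · have h1 : (2 * y + (((0 : Fin 2) : ℕ) : ℤ)) % 6 = 4 := by simp only [Fin.val_zero, Nat.cast_zero]; omega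
    rw [h, h1]; decide
  · have h1 : (2 * y + (((1 : Fin 2) : ℕ) : ℤ)) % 6 = 1 := by simp only [Fin.val_one, Nat.cast_one]; omega
    rw [h, h1]; decide
  · have h1 : (2 * y + (((1 : Fin 2) : ℕ) : ℤ)) % 6 = 3 := by simp only [Fin.val_one, Nat.cast_one]; omega
    rw [h, h1]; decide
  · have h1 : (2 * y + (((1 : Fin 2) : ℕ) : ℤ)) % 6 = 5 := by simp only [Fin.val_one, Nat.cast_one]; omega
    rw [h, h1]; decide

/-- Block-mates have the same normalised class: `NRM (CLS v)` depends only on the block label `v ∕ 2` (through `(v∕2) mod 3`). [certificate] -/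
theorem nrm_cls (v : ℤ) : NRM (CLS v) = if (v / 2) % 3 = 0 then (0 : Fin 3) else 1 := by
  beta_reduce
  have h6 : v % 6 = 0 ∨ v % 6 = 1 ∨ v % 6 = 2 ∨ v % 6 = 3 ∨ v % 6 = 4 ∨ v % 6 = 5 := by omega
  rcases h6 with h | h | h | h | h | h
  · have h1 : (v / 2) % 3 = 0 := by omega
    rw [h, h1]; decide
  · have h1 : (v / 2) % 3 = 0 := by omega
    rw [h, h1]; decide
  · have h1 : (v / 2) % 3 = 1 := by omega
    rw [h, h1]; decide
  · have h1 : (v / 2) % 3 = 1 := by omega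
    rw [h, h1]; decide
  · have h1 : (v / 2) % 3 = 2 := by omega
    rw [h, h1]; decide
  · have h1 : (v / 2) % 3 = 2 := by omega
    rw [h, h1]; decide

/-- `R3 v = 0 ↔ 3 ∣ v`. [folklore] -/
theorem r3_eq_zero_iff (v : ℤ) : R3 v = 0 ↔ (3 : ℤ) ∣ v := by
  beta_reduce
  rw [Int.dvd_iff_emod_eq_zero]
  have h3 : v % 3 = 0 ∨ v % 3 = 1 ∨ v % 3 = 2 := by omega
  rcases h3 with h | h | h <;> rw [h] <;> decide

/-- The window representatives of `(ℤ∕3)`: the class of `−2·ŵ` for `w = symmRep 3 x` is `0, 2, 1` for `x = 0, 1, 2`; as a closed check,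
`CLS (−(2·symmRep 3 x)) = CL6 ((−(2·symmRep 3 x)) mod 6)` evaluates by `decide`. [certificate] -/
theorem cls_corner : ∀ x : ZMod 3, CLS (-(side 1 * Beta.symmRep 3 x)) = (![0, 2, 1] : Fin 3 → Fin 3) x := by
  have hs : side 1 = 2 := by unfold side; norm_num
  rw [hs]
  decide

/-! ## §2. Quadruple reindexing of sums over `Fin 4 → α` -/

/-- `Σ_{τ : Fin 4 → α} G(τ₀,τ₁,τ₂,τ₃) = Σ_{t₀} Σ_{t₁} Σ_{t₂} Σ_{t₃} G(t₀,t₁,t₂,t₃)`. [folklore] -/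
theorem sum_pi_fin_four {α : Type*} [Fintype α] {β : Type*} [AddCommMonoid β] (G : α → α → α → α → β) :
    ∑ τ : Fin 4 → α, G (τ 0) (τ 1) (τ 2) (τ 3) = ∑ t₀ : α, ∑ t₁ : α, ∑ t₂ : α, ∑ t₃ : α, G t₀ t₁ t₂ t₃ := by
  let e4 : α × α × α × α ≃ (Fin 4 → α) :=
    { toFun := fun x => ![x.1, x.2.1, x.2.2.1, x.2.2.2]
      invFun := fun τ => (τ 0, τ 1, τ 2, τ 3)
      left_inv := fun x => rfl
      right_inv := fun τ => by funext i; fin_cases i <;> rfl }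
  rw [← Fintype.sum_equiv e4 (fun x => G x.1 x.2.1 x.2.2.1 x.2.2.2) (fun τ => G (τ 0) (τ 1) (τ 2) (τ 3)) (fun x => rfl)]
  rw [Fintype.sum_prod_type, Finset.sum_congr rfl fun t₀ _ => Fintype.sum_prod_type _]
  refine Finset.sum_congr rfl fun t₀ _ => Finset.sum_congr rfl fun t₁ _ => ?_
  rw [Fintype.sum_prod_type]

/-! ## §3. The finite checks (kernel `decide`; no `native_decide`) -/

/-- Every numerator is bounded by the denominator: `|TAB v| ≤ 479324085` (so `|PHI| ≤ 1`). [certificate] -/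
theorem TAB_abs_le : ∀ i j k l : Fin 3, -479324085 ≤ TAB i j k l ∧ TAB i j k l ≤ 479324085 := by decide

/-- **The Laplacian check**: the class-level Laplacian numerator is invariant under block-mate normalisation `C ↦ B` in every coordinate —
`−Δ PHI` is constant on blocks. [certificate] -/
theorem LAPT_norm : ∀ i j k l : Fin 3, LAPT i j k l = LAPT (NRM i) (NRM j) (NRM k) (NRM l) := by decide

/-- **The block-sum check**: over the 16 sites of the block with coarse residues `r`, the numerators sum to `16·479324085` if `r = 0` and to `0`
otherwise — `Q′ PHI = 1_{3ℤ⁴}`. [certificate] -/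
theorem BSUM_eq : ∀ r₀ r₁ r₂ r₃ : Fin 3,
    ∑ t₀ : Fin 2, ∑ t₁ : Fin 2, ∑ t₂ : Fin 2, ∑ t₃ : Fin 2, TAB (GG r₀ t₀) (GG r₁ t₁) (GG r₂ t₂) (GG r₃ t₃)
      = if r₀ = 0 ∧ r₁ = 0 ∧ r₂ = 0 ∧ r₃ = 0 then 16 * 479324085 else 0 := by
  simp only [Fin.sum_univ_two]
  decide

/-- **The corner-row check**: summed over the 81 coarse classes (read through the window representatives' corner classes `![0,2,1]`),
`Σ |TAB| = 1160634059`. [certificate] -/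
theorem CSUM_eq :
    ∑ c₀ : ZMod 3, ∑ c₁ : ZMod 3, ∑ c₂ : ZMod 3, ∑ c₃ : ZMod 3,
      |TAB ((![0, 2, 1] : Fin 3 → Fin 3) c₀) ((![0, 2, 1] : Fin 3 → Fin 3) c₁) ((![0, 2, 1] : Fin 3 → Fin 3) c₂)
        ((![0, 2, 1] : Fin 3 → Fin 3) c₃)| = 1160634059 := by
  decide

/-! ## §4. The certificate field on `ℤ⁴`: bounded, block sums `16·1_{3ℤ⁴}`, block-constant Laplacian ⟹ it IS the periodised kernel -/

/-- `|PHI p| ≤ 1`. [certificate] -/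
theorem abs_PHI_le (p : X 4) : |PHI p| ≤ 1 := by
  have h := TAB_abs_le (CLS (p 0)) (CLS (p 1)) (CLS (p 2)) (CLS (p 3))
  rw [abs_le]
  constructor
  · rw [show (-1 : ℝ) = ((-479324085 : ℤ) : ℝ) / 479324085 by norm_num]
    exact div_le_div_of_nonneg_right (Int.cast_le.mpr h.1) (by norm_num)
  · rw [show (1 : ℝ) = ((479324085 : ℤ) : ℝ) / 479324085 by norm_num]
    exact div_le_div_of_nonneg_right (Int.cast_le.mpr h.2) (by norm_num)

/-- One coordinate step: the two neighbours of `p` in direction `μ` carry the classes `NB1`, `NB2` of `p`'s class there, so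
`PHI(p + e_μ) + PHI(p − e_μ)` is the symmetric numerator pair over the denominator. [certificate] -/
theorem PHI_nbr_sum (p : X 4) (μ : Fin 4) :
    PHI (p + e μ) + PHI (p - e μ)
      = ((TAB (Function.update (fun ν => CLS (p ν)) μ (NB1 (CLS (p μ))) 0) (Function.update (fun ν => CLS (p ν)) μ (NB1 (CLS (p μ))) 1)
            (Function.update (fun ν => CLS (p ν)) μ (NB1 (CLS (p μ))) 2) (Function.update (fun ν => CLS (p ν)) μ (NB1 (CLS (p μ))) 3)
          + TAB (Function.update (fun ν => CLS (p ν)) μ (NB2 (CLS (p μ))) 0) (Function.update (fun ν => CLS (p ν)) μ (NB2 (CLS (p μ))) 1)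
            (Function.update (fun ν => CLS (p ν)) μ (NB2 (CLS (p μ))) 2) (Function.update (fun ν => CLS (p ν)) μ (NB2 (CLS (p μ))) 3)
          : ℤ) : ℝ) / 479324085 := by
  have hplus : (fun ν => CLS ((p + e μ) ν)) = Function.update (fun ν => CLS (p ν)) μ (CLS (p μ + 1)) := by
    funext ν
    by_cases hν : ν = μ
    · subst hν; simp only [Function.update_self, Pi.add_apply, e_apply_self]
    · simp only [Function.update_of_ne hν, Pi.add_apply, e_apply_ne hν, add_zero]
  have hminus : (fun ν => CLS ((p - e μ) ν)) = Function.update (fun ν => CLS (p ν)) μ (CLS (p μ - 1)) := by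
    funext ν
    by_cases hν : ν = μ
    · subst hν; simp only [Function.update_self, Pi.sub_apply, e_apply_self]
    · simp only [Function.update_of_ne hν, Pi.sub_apply, e_apply_ne hν, sub_zero]
  have key : ∀ q : X 4, PHI q = ((TAB ((fun ν => CLS (q ν)) 0) ((fun ν => CLS (q ν)) 1) ((fun ν => CLS (q ν)) 2)
      ((fun ν => CLS (q ν)) 3) : ℤ) : ℝ) / 479324085 := fun q => rfl
  rw [key (p + e μ), key (p - e μ), hplus, hminus, ← add_div, ← Int.cast_add]
  congr 2
  rcases cls_nbr (p μ) with ⟨h1, h2⟩ | ⟨h1, h2⟩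
  · rw [h1, h2]
  · rw [h1, h2, add_comm]

/-- **The Laplacian of the certificate field in class form**: `Σ_μ (2·PHI(p) − PHI(p+e_μ) − PHI(p−e_μ)) = LAPT(classes of p) ∕ 479324085`.
[certificate] -/
theorem lap_PHI (p : X 4) :
    ∑ μ, (2 * PHI p - PHI (p + e μ) - PHI (p - e μ))
      = ((LAPT (CLS (p 0)) (CLS (p 1)) (CLS (p 2)) (CLS (p 3)) : ℤ) : ℝ) / 479324085 := by
  have hstep : ∀ μ : Fin 4, 2 * PHI p - PHI (p + e μ) - PHI (p - e μ) = 2 * PHI p - (PHI (p + e μ) + PHI (p - e μ)) := fun μ => by ring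
  rw [Fin.sum_univ_four, hstep 0, hstep 1, hstep 2, hstep 3, PHI_nbr_sum p 0, PHI_nbr_sum p 1, PHI_nbr_sum p 2, PHI_nbr_sum p 3]
  simp only [Function.update_self, Function.update_of_ne (show (0 : Fin 4) ≠ 1 by decide),
    Function.update_of_ne (show (0 : Fin 4) ≠ 2 by decide), Function.update_of_ne (show (0 : Fin 4) ≠ 3 by decide),
    Function.update_of_ne (show (1 : Fin 4) ≠ 0 by decide), Function.update_of_ne (show (1 : Fin 4) ≠ 2 by decide),
    Function.update_of_ne (show (1 : Fin 4) ≠ 3 by decide), Function.update_of_ne (show (2 : Fin 4) ≠ 0 by decide),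
    Function.update_of_ne (show (2 : Fin 4) ≠ 1 by decide), Function.update_of_ne (show (2 : Fin 4) ≠ 3 by decide),
    Function.update_of_ne (show (3 : Fin 4) ≠ 0 by decide), Function.update_of_ne (show (3 : Fin 4) ≠ 1 by decide),
    Function.update_of_ne (show (3 : Fin 4) ≠ 2 by decide)]
  push_cast
  ring

/-- **`−Δ PHI` is block-constant**: block-mates have the same Laplacian (`LAPT_norm` + `nrm_cls`). [certificate] -/
theorem lap_PHI_blockConst (p p' : X 4) (h : blk 1 p = blk 1 p') :
    ∑ μ, (2 * PHI p - PHI (p + e μ) - PHI (p - e μ)) = ∑ μ, (2 * PHI p' - PHI (p' + e μ) - PHI (p' - e μ)) := by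
  rw [lap_PHI, lap_PHI, LAPT_norm (CLS (p 0)), LAPT_norm (CLS (p' 0))]
  have hs : side 1 = 2 := by unfold side; norm_num
  have hc : ∀ μ : Fin 4, NRM (CLS (p μ)) = NRM (CLS (p' μ)) := by
    intro μ
    have hμ : p μ / 2 = p' μ / 2 := by
      have := congr_fun h μ
      simp only [blk, hs] at this
      exact this
    rw [nrm_cls, nrm_cls, hμ]
  rw [hc 0, hc 1, hc 2, hc 3]

/-- **Block sums of the certificate field**: `Σ_{q∈B(z)} PHI q = 16·1_{3ℤ⁴}(z)`. [certificate] -/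
theorem blockSum_PHI (z : X 4) :
    ∑ q ∈ B 1 z, PHI q = (((1 : ℕ) : ℝ) + 1) ^ 4 * Set.indicator (Set.range (Beta.imageShift 3 (0 : X 4))) (fun _ => (1 : ℝ)) z := by
  rw [sum_B]
  have hq : ∀ τ : Fin 4 → Fin 2, PHI (chart 1 z τ)
      = ((TAB (GG (R3 (z 0)) (τ 0)) (GG (R3 (z 1)) (τ 1)) (GG (R3 (z 2)) (τ 2)) (GG (R3 (z 3)) (τ 3)) : ℤ) : ℝ) / 479324085 := by
    intro τ
    have hcoord : ∀ μ : Fin 4, CLS (chart 1 z τ μ) = GG (R3 (z μ)) (τ μ) := fun μ => cls_chart (z μ) (τ μ)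
    show ((TAB (CLS (chart 1 z τ 0)) (CLS (chart 1 z τ 1)) (CLS (chart 1 z τ 2)) (CLS (chart 1 z τ 3)) : ℤ) : ℝ) / 479324085 = _
    rw [hcoord 0, hcoord 1, hcoord 2, hcoord 3]
  simp only [hq]
  rw [← Finset.sum_div, sum_pi_fin_four (fun t₀ t₁ t₂ t₃ =>
    ((TAB (GG (R3 (z 0)) t₀) (GG (R3 (z 1)) t₁) (GG (R3 (z 2)) t₂) (GG (R3 (z 3)) t₃) : ℤ) : ℝ))]
  have hZ := BSUM_eq (R3 (z 0)) (R3 (z 1)) (R3 (z 2)) (R3 (z 3))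
  have hR : (∑ t₀ : Fin 2, ∑ t₁ : Fin 2, ∑ t₂ : Fin 2, ∑ t₃ : Fin 2,
      ((TAB (GG (R3 (z 0)) t₀) (GG (R3 (z 1)) t₁) (GG (R3 (z 2)) t₂) (GG (R3 (z 3)) t₃) : ℤ) : ℝ))
      = ((if R3 (z 0) = 0 ∧ R3 (z 1) = 0 ∧ R3 (z 2) = 0 ∧ R3 (z 3) = 0 then 16 * 479324085 else 0 : ℤ) : ℝ) := by
    rw [← hZ]; push_cast; rfl
  rw [hR]
  have hiff : (R3 (z 0) = 0 ∧ R3 (z 1) = 0 ∧ R3 (z 2) = 0 ∧ R3 (z 3) = 0) ↔ z ∈ Set.range (Beta.imageShift 3 (0 : X 4)) := by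
    rw [mem_range_imageShift_iff, r3_eq_zero_iff, r3_eq_zero_iff, r3_eq_zero_iff, r3_eq_zero_iff]
    constructor
    · rintro ⟨h0', h1', h2', h3'⟩ i
      fin_cases i <;> simpa using ‹_›
    · intro h
      have h' : ∀ i, (3 : ℤ) ∣ z i := fun i => by simpa using h i
      exact ⟨h' 0, h' 1, h' 2, h' 3⟩
  by_cases hz : z ∈ Set.range (Beta.imageShift 3 (0 : X 4))
  · rw [if_pos (hiff.mpr hz), Set.indicator_of_mem hz]
    push_cast; norm_num
  · rw [if_neg (fun h => hz (hiff.mp h)), Set.indicator_of_notMem hz]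
    push_cast; norm_num

/-- **THE CERTIFICATE FIELD IS THE PERIODISED ONE-SHOT KERNEL** (side 2, d = 4, coarse period 3, every `a > 0`):
`Σ′_m H(p, 3m) = PHI p` for every `p ∈ ℤ⁴` (`OneShotChartBoundedUniqueness.images_eq_of_blockHarmonic`). [certificate] -/
theorem images_eq_PHI {a : ℝ} (ha : 0 < a) (p : X 4) :
    ∑' m : X 4, kerH 1 a p (Beta.imageShift 3 (0 : X 4) m) = PHI p :=
  images_eq_of_blockHarmonic 1 ha 3 (0 : X 4) (φ := fun q => PHI q) (fun r => abs_PHI_le r) (fun q q' h => lap_PHI_blockConst q q' h)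
    (fun z => blockSum_PHI z) p

/-! ## §5. The torus corner row and the `ℤ⁴` row: `Σ′_y |H(0,y)| ≥ 1160634059 ∕ 479324085` -/

/-- The image series at the window representative `ĉ` read at the origin is the certificate at the corner `−2ĉ` (block covariance (54)).
[certificate] -/
theorem images_window_eq {a : ℝ} (ha : 0 < a) (c : Beta.Site 4 3) :
    ∑' m : X 4, kerH 1 a 0 (Beta.imageShift 3 (Beta.windowMap 4 3 c) m) = PHI (-(side 1 • Beta.windowMap 4 3 c)) := by
  rw [← images_eq_PHI ha]
  refine tsum_congr fun m => ?_
  have h := kerH_translate 1 ha (Beta.windowMap 4 3 c) (-(side 1 • Beta.windowMap 4 3 c)) (Beta.imageShift 3 (0 : X 4) m)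
  rw [neg_add_cancel] at h
  rw [← h]
  congr 1
  funext i
  simp only [Beta.imageShift_apply, Pi.add_apply, Pi.zero_apply, zero_add]
  ring

/-- **THE TORUS CORNER ROW SUM**: `Σ_{c : (ℤ∕3)⁴} |Σ′_m H(0, ĉ + 3m)| = 1160634059 ∕ 479324085` (exact). [certificate] -/
theorem sum_abs_images_zero_eq {a : ℝ} (ha : 0 < a) :
    ∑ c : Beta.Site 4 3, |∑' m : X 4, kerH 1 a 0 (Beta.imageShift 3 (Beta.windowMap 4 3 c) m)| = 1160634059 / 479324085 := by
  simp only [images_window_eq ha]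
  have hcls : ∀ (c : Beta.Site 4 3) (μ : Fin 4), CLS ((-(side 1 • Beta.windowMap 4 3 c)) μ)
      = (![0, 2, 1] : Fin 3 → Fin 3) (c μ) := by
    intro c μ
    have h := cls_corner (c μ)
    simp only [Pi.neg_apply, Pi.smul_apply, smul_eq_mul, Beta.windowMap]
    exact h
  have hterm : ∀ c : Beta.Site 4 3, |PHI (-(side 1 • Beta.windowMap 4 3 c))|
      = ((|TAB ((![0, 2, 1] : Fin 3 → Fin 3) (c 0)) ((![0, 2, 1] : Fin 3 → Fin 3) (c 1))
          ((![0, 2, 1] : Fin 3 → Fin 3) (c 2)) ((![0, 2, 1] : Fin 3 → Fin 3) (c 3))| : ℤ) : ℝ) / 479324085 := by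
    intro c
    show |((TAB (CLS ((-(side 1 • Beta.windowMap 4 3 c)) 0)) (CLS ((-(side 1 • Beta.windowMap 4 3 c)) 1))
      (CLS ((-(side 1 • Beta.windowMap 4 3 c)) 2)) (CLS ((-(side 1 • Beta.windowMap 4 3 c)) 3)) : ℤ) : ℝ) / 479324085| = _
    rw [hcls c 0, hcls c 1, hcls c 2, hcls c 3, abs_div, abs_of_pos (by norm_num : (0 : ℝ) < 479324085), Int.cast_abs]
  simp only [hterm]
  rw [← Finset.sum_div, sum_pi_fin_four (fun c₀ c₁ c₂ c₃ : ZMod 3 => ((|TAB ((![0, 2, 1] : Fin 3 → Fin 3) c₀) ((![0, 2, 1] : Fin 3 → Fin 3) c₁)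
    ((![0, 2, 1] : Fin 3 → Fin 3) c₂) ((![0, 2, 1] : Fin 3 → Fin 3) c₃)| : ℤ) : ℝ))]
  have hZ := CSUM_eq
  congr 1
  exact_mod_cast hZ

/-- **THE `ℤ⁴` ROW SUM OF THE SIDE-2 ONE-SHOT SECTION IS AT LEAST `1160634059 ∕ 479324085 = 2.4213…`** at the origin, for every `a > 0`
(the OWNER's (54) `sum_abs_tsum_kerH_images_le`: torus rows are bounded by the `ℤ⁴` row). [certificate + folklore] -/
theorem rowSum_zero_ge {a : ℝ} (ha : 0 < a) : (1160634059 / 479324085 : ℝ) ≤ ∑' y : X 4, |kerH 1 a 0 y| := by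
  rw [← sum_abs_images_zero_eq ha]
  exact sum_abs_tsum_kerH_images_le 1 ha 3 0

/-- `2 < Σ′_y |H(0,y)|` at side 2 on `ℤ⁴`. [certificate + folklore] -/
theorem two_lt_rowSum_zero {a : ℝ} (ha : 0 < a) : (2 : ℝ) < ∑' y : X 4, |kerH 1 a 0 y| :=
  lt_of_lt_of_le (by norm_num) (rowSum_zero_ge ha)

/-! ## §6. THE KERNEL NEGATIVE SUP LETTER AT `(M, d) = (2, 4)` -/

/-- No sup letter with any constant `K < 1160634059 ∕ 479324085 = 2.4213…` for the side-2 section on `ℤ⁴` (every `a > 0`; leaf-03's SUPSHARP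
`not_sup_letter_of_rowSum_gt` at the offset `τ = 0`, `chart 1 0 0 = 0`). [certificate + folklore] -/
theorem not_sup_letter_of_lt {a : ℝ} (ha : 0 < a) {K : ℝ} (hK : K < 1160634059 / 479324085) :
    ¬ ∀ (Bf : X 4 → ℝ) (R : ℝ), (∀ y, |Bf y| ≤ R) → ∀ z : X 4, |HBZd 1 a Bf z| ≤ K * R := by
  refine not_sup_letter_of_rowSum_gt 1 ha (0 : Fin 4 → Fin 2) ?_
  have h0 : chart 1 (0 : X 4) (0 : Fin 4 → Fin 2) = 0 := by
    funext μ; simp [chart]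
  rw [h0]
  exact lt_of_lt_of_le hK (rowSum_zero_ge ha)

/-- **NL-NE7b-2° AT SIDE 2 (kernel negative knowledge)**: the pure-sup one-shot chart letter with constant `K = M^{(d−2)∕2} = 2` is FALSE
for the side-2 section on `ℤ⁴`: `¬ ∀ B R, (∀ y, |B y| ≤ R) → ∀ z, |(H_2 B)(z)| ≤ 2·R` (every `a > 0`). [certificate + folklore] -/
theorem not_sup_letter_side_two {a : ℝ} (ha : 0 < a) :
    ¬ ∀ (Bf : X 4 → ℝ) (R : ℝ), (∀ y, |Bf y| ≤ R) → ∀ z : X 4, |HBZd 1 a Bf z| ≤ 2 * R :=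
  not_sup_letter_of_lt ha (K := 2) (by norm_num)

end

end Summit.QuantumFields.BalabanUV.T4Continuum.NE7b.OneShotChartTorusCertificateSideTwo
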